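/-
COR-CM (cell pub-hodgecm2, stage 2 of the Hodge ladder) — count-neutral KERNEL COMBINATORICS «the order-16 dispatch», part II: the NORMAL FORM and the
COMMUTATOR SUBGROUP of a non-abelian exponent-4 group of order 16 (seat prover-pub-hodgecm2-b23-g55-0, binder prover b23, gen 55; claim HOME/INBOX.md
l.25631).  Theorems only; no `decide`, no certificate, no named fact, no `sorry`.  `Interfaces.lean` (C1), every E term, B01, `Transposition/*`,
`PortJoin/*`, `D2Bridge/*` untouched.
HONEST FRAMING: `HC_CM` is NOT proved, here or anywhere in the tree; nothing here is a period, a count of record or a headline.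
T5: n/a-class (hypothesis binders `|G| = 16`, no element of order `8`, a non-commuting pair `a, b` — inhabited by `D₄ × ℤ/2`, `Q₈ × ℤ/2`, the Pauli
group, `ℤ/4 ⋊ ℤ/4`, `G(16,3)`); checker: self.
-/
import Summits.HodgeConjecture.CorCM.Census.OrderSixteenStructure

/-!
# The order-16 dispatch, II: the normal form and the commutator subgroup

For a finite group `G` of order `16` without an element of order `8` and a non-commuting pair `a, b` (part I: every square and every commutator is
central, `|Z(G)| = 4`):
* **the normal form** `G = Z ∪ aZ ∪ bZ ∪ abZ` (`exists_normalForm`) — `G ⧸ Z(G)` is the Klein group on `ā, b̄`;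
* **every commutator is `1` or `⁅a, b⁆`** (`commutatorElement_eq_one_or_eq`, bilinearity of the central commutator), hence
  **`[G, G] ≤ ⟨⁅a,b⁆⟩ = {1, ⁅a,b⁆}`** (`commutator_le_zpowers`) and a non-trivial `c ∈ [G, G]` IS `⁅a, b⁆` (`eq_commutatorElement_of_mem_commutator`,
  `mul_eq_of_mem_commutator`: `a b = c · b a`).
All [folklore].

## References
* [Pohlmann1968] H. Pohlmann, Algebraic cycles on abelian varieties of complex multiplication type, Ann. of Math. 88 (1968), Thm 1.
-/

namespace Summit.HodgeConjecture.CorCM.Census.OrderSixteen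

open Subgroup
open scoped commutatorElement

variable {G : Type*} [Group G]

section Commutator

variable [Finite G] (hG : Nat.card G = 16) (h8 : ∀ u : G, orderOf u ≠ 8)
include hG h8

/-- **THE NORMAL FORM**: for non-commuting `a, b`, every element is `z`, `a z`, `b z` or `a b z` with `z` central (`G ⧸ Z(G)` is the Klein group on
`ā, b̄`). [folklore] -/
theorem exists_normalForm {a b : G} (hab : a * b ≠ b * a) (g : G) :
    ∃ z ∈ center G, g = z ∨ g = a * z ∨ g = b * z ∨ g = a * b * z := by
  classical
  let Z := center G
  let π : G →* G ⧸ Z := QuotientGroup.mk' Z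
  haveI : Fintype (G ⧸ Z) := Fintype.ofFinite _
  have hq : Nat.card G = Nat.card (G ⧸ Z) * Nat.card Z := Subgroup.card_eq_card_quotient_mul_card_subgroup _
  have hZ4 : Nat.card Z = 4 := card_center_eq_four hG h8 hab
  rw [hG, hZ4] at hq
  have hq4 : Fintype.card (G ⧸ Z) = 4 := by rw [← Nat.card_eq_fintype_card]; omega
  -- the four cosets `Z, aZ, bZ, abZ` are distinct
  have hne : ∀ {x y : G}, x⁻¹ * y ∉ Z → π x ≠ π y := fun {x y} h e => h (by
    rwa [QuotientGroup.mk'_apply, QuotientGroup.mk'_apply, QuotientGroup.eq] at e)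
  have haZ : a ∉ Z := fun h => hab ((mem_center_iff.mp h b)).symm
  have hbZ : b ∉ Z := fun h => hab (mem_center_iff.mp h a)
  have habZ : a * b ∉ Z := fun h => hab (by
    have e := mem_center_iff.mp h a
    rw [mul_assoc] at e
    exact mul_left_cancel e)
  have hab' : a⁻¹ * b ∉ Z := fun h => hab (by
    have e := mem_center_iff.mp h a
    rw [← mul_assoc, mul_inv_cancel, one_mul] at e
    calc a * b = a * (a⁻¹ * b * a) := by rw [← e]
      _ = b * a := by group)
  have hbab : b⁻¹ * (a * b) ∉ Z := fun h => hab (by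
    have e := mem_center_iff.mp h b
    rw [mul_inv_cancel_left] at e
    have e2 : b * (a * b) = a * b * b := by
      calc b * (a * b) = b * (b⁻¹ * (a * b) * b) := by rw [← e]
        _ = a * b * b := by group
    rw [← mul_assoc] at e2
    exact (mul_right_cancel e2).symm)
  have h1a : π 1 ≠ π a := hne (by simpa using haZ)
  have h1b : π 1 ≠ π b := hne (by simpa using hbZ)
  have h1ab : π 1 ≠ π (a * b) := hne (by simpa using habZ)
  have hab2 : π a ≠ π b := hne hab'
  have haab : π a ≠ π (a * b) := hne (by simpa using hbZ)
  have hbab' : π b ≠ π (a * b) := hne hbab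
  -- hence they exhaust `G ⧸ Z`
  have huniv : ({π 1, π a, π b, π (a * b)} : Finset (G ⧸ Z)) = Finset.univ := by
    apply Finset.eq_univ_of_card
    rw [hq4]
    simp only [Finset.card_insert_of_notMem, Finset.mem_insert, Finset.mem_singleton, h1a, h1b, h1ab, hab2, haab, hbab',
      or_self, not_false_eq_true, Finset.card_singleton]
  have hmem : π g ∈ ({π 1, π a, π b, π (a * b)} : Finset (G ⧸ Z)) := huniv ▸ Finset.mem_univ _
  have hback : ∀ {x : G}, π g = π x → ∃ z ∈ Z, g = x * z := fun {x} e => by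
    rw [QuotientGroup.mk'_apply, QuotientGroup.mk'_apply, eq_comm, QuotientGroup.eq] at e
    exact ⟨x⁻¹ * g, e, by group⟩
  simp only [Finset.mem_insert, Finset.mem_singleton] at hmem
  rcases hmem with h | h | h | h
  · obtain ⟨z, hz, hgz⟩ := hback h; exact ⟨z, hz, Or.inl (by rw [hgz, one_mul])⟩
  · obtain ⟨z, hz, hgz⟩ := hback h; exact ⟨z, hz, Or.inr (Or.inl hgz)⟩
  · obtain ⟨z, hz, hgz⟩ := hback h; exact ⟨z, hz, Or.inr (Or.inr (Or.inl hgz))⟩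
  · obtain ⟨z, hz, hgz⟩ := hback h; exact ⟨z, hz, Or.inr (Or.inr (Or.inr hgz))⟩

/-- **Every commutator is `1` or `⁅a, b⁆`** (bilinearity of the central commutator and the normal form). [folklore] -/
theorem commutatorElement_eq_one_or_eq {a b : G} (hab : a * b ≠ b * a) (g h : G) : ⁅g, h⁆ = 1 ∨ ⁅g, h⁆ = ⁅a, b⁆ := by
  have hcc := commutatorElement_comm hG h8
  have hzc : ∀ {z : G}, z ∈ center G → ∀ x : G, x * z = z * x := fun hz x => mem_center_iff.mp hz x
  -- the set `{1, ⁅a,b⁆}` is closed under products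
  have hmul : ∀ {s t : G}, (s = 1 ∨ s = ⁅a, b⁆) → (t = 1 ∨ t = ⁅a, b⁆) → (s * t = 1 ∨ s * t = ⁅a, b⁆) := by
    rintro s t (rfl | rfl) (rfl | rfl)
    · exact Or.inl (one_mul 1)
    · exact Or.inr (one_mul _)
    · exact Or.inr (mul_one _)
    · exact Or.inl (commutatorElement_mul_self hG h8 a b)
  -- first slot `a` or `b`, second slot in normal form
  have hright : ∀ {x : G}, (⁅x, a⁆ = 1 ∨ ⁅x, a⁆ = ⁅a, b⁆) → (⁅x, b⁆ = 1 ∨ ⁅x, b⁆ = ⁅a, b⁆) →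
      ∀ h : G, ⁅x, h⁆ = 1 ∨ ⁅x, h⁆ = ⁅a, b⁆ := by
    intro x hxa hxb h
    obtain ⟨z, hz, hh⟩ := exists_normalForm hG h8 hab h
    have hxz : ⁅x, z⁆ = 1 := commutatorElement_eq_one_of_central_right (hzc hz)
    rcases hh with rfl | rfl | rfl | rfl
    · exact Or.inl hxz
    · rw [commutatorElement_mul_right (hcc x z), hxz, mul_one]; exact hxa
    · rw [commutatorElement_mul_right (hcc x z), hxz, mul_one]; exact hxb
    · rw [commutatorElement_mul_right (hcc x z), hxz, mul_one, commutatorElement_mul_right (hcc x b)]; exact hmul hxa hxb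
  have haa : ⁅a, a⁆ = 1 := commutatorElement_eq_one_iff_mul_comm.mpr rfl
  have hbb : ⁅b, b⁆ = 1 := commutatorElement_eq_one_iff_mul_comm.mpr rfl
  have hba : ⁅b, a⁆ = ⁅a, b⁆ := commutatorElement_symm hG h8 a b
  have ha : ∀ h : G, ⁅a, h⁆ = 1 ∨ ⁅a, h⁆ = ⁅a, b⁆ := hright (Or.inl haa) (Or.inr rfl)
  have hb : ∀ h : G, ⁅b, h⁆ = 1 ∨ ⁅b, h⁆ = ⁅a, b⁆ := hright (Or.inr hba) (Or.inl hbb)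
  -- first slot in normal form
  obtain ⟨z, hz, hg⟩ := exists_normalForm hG h8 hab g
  have hzh : ⁅z, h⁆ = 1 := commutatorElement_eq_one_of_central_left (hzc hz)
  rcases hg with rfl | rfl | rfl | rfl
  · exact Or.inl hzh
  · rw [commutatorElement_mul_left (hcc z h), hzh, mul_one]; exact ha h
  · rw [commutatorElement_mul_left (hcc z h), hzh, mul_one]; exact hb h
  · rw [commutatorElement_mul_left (hcc z h), hzh, mul_one, commutatorElement_mul_left (hcc b h)]; exact hmul (ha h) (hb h)

/-- **`[G, G] ≤ ⟨⁅a, b⁆⟩ = {1, ⁅a,b⁆}`** for any non-commuting `a, b`. [folklore] -/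
theorem commutator_le_zpowers {a b : G} (hab : a * b ≠ b * a) : commutator G ≤ zpowers ⁅a, b⁆ := by
  rw [commutator_def]
  exact Subgroup.commutator_le.mpr fun g _ h _ => by
    rcases commutatorElement_eq_one_or_eq hG h8 hab g h with e | e
    · rw [e]; exact (zpowers ⁅a, b⁆).one_mem
    · rw [e]; exact mem_zpowers _

/-- **A non-trivial element of `[G, G]` IS the commutator `⁅a, b⁆`** of any non-commuting pair. [folklore] -/
theorem eq_commutatorElement_of_mem_commutator {a b c : G} (hab : a * b ≠ b * a) (hc : c ∈ commutator G) (hc1 : c ≠ 1) :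
    c = ⁅a, b⁆ := by
  have hmem := commutator_le_zpowers hG h8 hab hc
  have hmem' : c ∈ Submonoid.powers ⁅a, b⁆ := ((isOfFinOrder_of_finite ⁅a, b⁆).mem_powers_iff_mem_zpowers).mpr hmem
  obtain ⟨k, hk⟩ := (Submonoid.mem_powers_iff _ _).mp hmem'
  have hsq : ⁅a, b⁆ ^ 2 = 1 := by rw [pow_two, commutatorElement_mul_self hG h8]
  have hk' : ⁅a, b⁆ ^ k = ⁅a, b⁆ ^ (k % 2) := by
    conv_lhs => rw [← Nat.div_add_mod k 2, pow_add, pow_mul, hsq, one_pow, one_mul]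
  rcases Nat.mod_two_eq_zero_or_one k with h | h
  · rw [h, pow_zero] at hk'; rw [← hk, hk'] at hc1; exact absurd rfl hc1
  · rw [← hk, hk', h, pow_one]

/-- **The commutator of a non-commuting pair is the given central involution `c ∈ [G, G]`**, packaged: `a b = c · b a`. [folklore] -/
theorem mul_eq_of_mem_commutator {a b c : G} (hab : a * b ≠ b * a) (hc : c ∈ commutator G) (hc1 : c ≠ 1) :
    a * b = c * (b * a) := by
  have h := eq_commutatorElement_of_mem_commutator hG h8 hab hc hc1
  rw [commutatorElement_def] at h
  rw [h]; group

end Commutator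

end Summit.HodgeConjecture.CorCM.Census.OrderSixteen
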